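import Literature.AnabelianGeometry.SemiGraphs.MetabelianLeafStarExoticIsolation
import Literature.AnabelianGeometry.SemiGraphs.TemperedGalFiniteSubgroupsBounded
import HarnessLib

/-!
# Exotic compact subgroups of `π₁^temp(𝒢⋆(p))` are TORSION-FREE, and `p`-th ROOTS are UNIQUE among exotic
# compact elements («UNIQUE-ROOTS@STAR»)

Mochizuki, *Semi-graphs of anabelioids*, Publ. RIMS **42** (2006), §3, Theorem 3.7 (iv), manuscript p. 41 (maximal
compact subgroups and their intersections), Remark 2.2.1 p. 24 [cite: MochizukiSemiAnbd2006, Thm 3.7(iv) p.41].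

PROOF-ONLY file (abc-iut cell, layer L3, row «UNIQUE-ROOTS@STAR», seat abc-iut-L3-t8 gen 9; no definition, no named
fact).  Canonical chart of the rayless star `𝒢⋆(p) = metabelianLeafStar p`.  Two structural corollaries of this seat's
certificate machinery (`MetabelianLeafStarAnchorFreeCertificate.lean`, F2) and ISOLATION theorem
(`MetabelianLeafStarExoticIsolation.lean`, F4):

* `pow_fixes_edge` — the powers of an element fixing a tree edge fix it;
* **`eq_one_of_pow_prime_eq_one_of_fixes_edges`** — an element `t` with `t^p = 1` that fixes some edge of every deep
  level tree is trivial: the `a`-character `Φ₀` modulo `p^{e₀}` that sees `t` (F2) and the character modulo `p^{e₀+1}`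
  read `t` through the SAME exponent `κ` at one fixed edge; `Φ₁(t)^p = 1` forces `p^{e₀} ∣ κ`, i.e. `Φ₀(t) = 1`;
* **`eq_one_of_isOfFinOrder_of_fixes_edges`** — hence NO torsion among the elements fixing edges at all deep levels
  (a `p'`-part is killed by the `p`-group-valued character outright);
* ★ **`metabelianLeafStar_eq_one_of_isOfFinOrder_of_forall_not_le`** — every compact subgroup of `π₁^temp(𝒢⋆(p))`
  lying in no verticial subgroup (in particular every EXOTIC MAXIMAL compact subgroup) is TORSION-FREE;
* ★ **`metabelianLeafStar_eq_of_pow_prime_eq`** — UNIQUE `p`-th ROOTS among exotic compact elements: if `a ≠ 1`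
  generates a compact subgroup lying in no verticial subgroup, `b` generates a compact subgroup, and `a^p = b^p`,
  then `a = b` (the maximal compact `K₀ ⊇ ⟨a⟩‾` — Zorn, `exists_isMaximalCompactSubgroup_ge_temperedPiChart` — is
  exotic, hence ISOLATED (F4: `⟨b⟩‾ ≤ K₀`) and COMMUTATIVE (abc-iut-w6-d064), so `(ab⁻¹)^p = 1` in the torsion-free
  `K₀`).

Honest framing: OUR typed tempered fundamental group of OUR countable carrier `𝒢⋆(p)`; nothing here bears on [IUTchIII]
Cor. 3.12; no side taken; typed ≠ proved.
-/

noncomputable section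

open CategoryTheory Topology Multiplicative Filter

namespace Literature.AnabelianGeometry.SemiGraphs

open IwahoriWitness

namespace ProfiniteSemiGraph

variable {p : ℕ} [hp : Fact p.Prime] {h36 : (metabelianLeafStar p).Prop36Hypotheses}

/-! ### Powers fix fixed edges -/

/-- The powers of an element fixing a tree edge fix it. [cite: MochizukiSemiAnbd2006, Lem. 1.8(ii) p.20] -/
theorem pow_fixes_edge {𝒢 : ProfiniteSemiGraph.{0}} {D : GaloisLevelData 𝒢} {h𝒢 : 𝒢.IsCountable} (j : ℕ)
    (d : D.temperedPi h𝒢) {ε : (D.tree j).Edge} (hε : (D.treeAct h𝒢 j d).hom.edgeMap ε = ε) (k : ℕ) :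
    (D.treeAct h𝒢 j (d ^ k)).hom.edgeMap ε = ε := by
  induction k with
  | zero => rw [pow_zero, map_one]; rfl
  | succ k ih =>
    rw [pow_succ, map_mul]
    change ((D.treeAct h𝒢 j d).hom ≫ (D.treeAct h𝒢 j (d ^ k)).hom).edgeMap ε = ε
    rw [SemiGraph.comp_edgeMap, Function.comp_apply, hε, ih]

/-! ### No `p`-torsion among the elements fixing edges at all deep levels -/

/-- **An element `t` of `π₁^temp(𝒢⋆(p))` with `t^p = 1` fixing some tree edge at every level `≥ i₀` is trivial.**
If not, the `a`-character `Φ₀` modulo `p^{e₀}` sees `t` (F2); the `a`-character `Φ₁` modulo `p^{e₀+1}` and `Φ₀` read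
`t` through the same exponent `κ` of one fixed edge of a common deep level, `Φ₁(t) = κ`, `Φ₀(t) = κ`; but
`Φ₁(t)^p = Φ₁(t^p) = 1` gives `p^{e₀+1} ∣ p·κ`, so `Φ₀(t) = 1`. [cite: MochizukiSemiAnbd2006, Thm 3.7(iv) p.41] -/
theorem eq_one_of_pow_prime_eq_one_of_fixes_edges
    (t : ((metabelianLeafStar p).galoisLevelData h36).temperedPi h36.isCountable) (ht : t ^ p = 1) (i₀ : ℕ)
    (hfix : ∀ M, i₀ ≤ M → ∃ ε : (((metabelianLeafStar p).galoisLevelData h36).tree M).Edge,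
      (((metabelianLeafStar p).galoisLevelData h36).treeAct h36.isCountable M t).hom.edgeMap ε = ε) :
    t = 1 := by
  haveI : NeZero p := ⟨hp.out.ne_zero⟩
  by_contra ht1
  obtain ⟨P₀⟩ := GaloisLevelData.nonempty_pointSeq h36 (leafStarCentre p)
  obtain ⟨e₀, Φ₀, j₀, hΦ₀P, -, hker₀, hΦ₀t⟩ := exists_aCharacter_ne_one_of_fixes_edges P₀ t ht1 i₀ hfix
  obtain ⟨Φ₁, j₁, hΦ₁P, -, hker₁⟩ := exists_linCharacter₂ h36 (e₀ + 1) (1 : ZMod (p ^ (e₀ + 1))) 0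
  -- one fixed edge at a common deep level, read by both characters
  let M := max (max j₀ j₁) i₀
  obtain ⟨ε, hε⟩ := hfix M (le_max_right _ _)
  obtain ⟨a, f, κ, h⟩ := exists_proj_eq_conj_θα_of_edgeMap_eq P₀ M t ε hε
  have h0 := linCharacter_eq_of_proj_eq_conj_θα P₀ Φ₀ hΦ₀P (hker₀ M ((le_max_left _ _).trans (le_max_left _ _))) h
  have h1 := linCharacter_eq_of_proj_eq_conj_θα P₀ Φ₁ hΦ₁P (hker₁ M ((le_max_right _ _).trans (le_max_left _ _))) h
  rw [zero_mul, add_zero, one_mul] at h0 h1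
  -- `Φ₁(t)^p = 1`
  set x : ZMod (p ^ (e₀ + 1)) := PadicInt.toZModPow (e₀ + 1) κ.toAdd with hx
  have hp1 : (p : ZMod (p ^ (e₀ + 1))) * x = 0 := by
    have h2 : Φ₁ t ^ p = 1 := by rw [← map_pow, ht, map_one]
    rw [h1, ← ofAdd_nsmul, nsmul_eq_mul] at h2
    exact ofAdd_eq_one.mp h2
  -- hence `p^{e₀} ∣ κ`, i.e. `Φ₀(t) = 1`
  have hdvd : p ^ e₀ ∣ p ^ (e₀ + 1) := pow_dvd_pow p (Nat.le_succ e₀)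
  have hcast : (ZMod.castHom hdvd (ZMod (p ^ e₀))) x = PadicInt.toZModPow e₀ κ.toAdd := by
    rw [hx, ← RingHom.comp_apply, PadicInt.zmod_cast_comp_toZModPow e₀ (e₀ + 1) (Nat.le_succ e₀)]
  have hint : ((p : ℤ) ^ (e₀ + 1)) ∣ (p : ℤ) * (x.val : ℤ) := by
    have h3 : (((p : ℤ) * (x.val : ℤ) : ℤ) : ZMod (p ^ (e₀ + 1))) = 0 := by
      push_cast
      rw [ZMod.natCast_zmod_val]
      exact hp1
    have h4 := (ZMod.intCast_zmod_eq_zero_iff_dvd _ (p ^ (e₀ + 1))).mp h3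
    push_cast at h4
    exact h4
  have hp0 : (p : ℤ) ≠ 0 := by exact_mod_cast hp.out.ne_zero
  have hdiv : (p ^ e₀ : ℕ) ∣ x.val := by
    rw [pow_succ'] at hint
    have h5 : (p : ℤ) ^ e₀ ∣ (x.val : ℤ) := (mul_dvd_mul_iff_left hp0).mp hint
    exact_mod_cast h5
  apply hΦ₀t
  rw [h0, ← hcast, ZMod.castHom_apply, ZMod.cast_eq_val, (ZMod.natCast_eq_zero_iff _ _).mpr hdiv, ofAdd_zero]

/-- **No torsion among the elements of `π₁^temp(𝒢⋆(p))` fixing edges at all deep levels**: an element of finite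
order fixing some tree edge at every level `≥ i₀` is trivial.  (If `p` divides the order, a power has order `p` and
fixes the same edges; otherwise the `a`-character, valued in a `p`-group, kills the element.)
[cite: MochizukiSemiAnbd2006, Thm 3.7(iv) p.41] -/
theorem eq_one_of_isOfFinOrder_of_fixes_edges
    (t : ((metabelianLeafStar p).galoisLevelData h36).temperedPi h36.isCountable) (ht : IsOfFinOrder t) (i₀ : ℕ)
    (hfix : ∀ M, i₀ ≤ M → ∃ ε : (((metabelianLeafStar p).galoisLevelData h36).tree M).Edge,
      (((metabelianLeafStar p).galoisLevelData h36).treeAct h36.isCountable M t).hom.edgeMap ε = ε) :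
    t = 1 := by
  haveI : NeZero p := ⟨hp.out.ne_zero⟩
  by_contra ht1
  have hm : 0 < orderOf t := ht.orderOf_pos
  by_cases hdvd : p ∣ orderOf t
  · -- a power of `t` has order `p` and fixes the same edges
    have hord : orderOf (t ^ (orderOf t / p)) = p := orderOf_pow_orderOf_div hm.ne' hdvd
    have hpow : (t ^ (orderOf t / p)) ^ p = 1 := by
      have h := pow_orderOf_eq_one (t ^ (orderOf t / p))
      rwa [hord] at h
    have hne : t ^ (orderOf t / p) ≠ 1 := by
      intro h1
      have h2 : orderOf (t ^ (orderOf t / p)) = 1 := by rw [h1, orderOf_one]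
      rw [hord] at h2
      exact hp.out.one_lt.ne' h2
    exact hne (eq_one_of_pow_prime_eq_one_of_fixes_edges (t ^ (orderOf t / p)) hpow i₀ fun M hM => by
      obtain ⟨ε, hε⟩ := hfix M hM
      exact ⟨ε, pow_fixes_edge M t hε _⟩)
  · -- order prime to `p`: the `a`-character (valued in a `p`-group) kills `t`
    obtain ⟨P₀⟩ := GaloisLevelData.nonempty_pointSeq h36 (leafStarCentre p)
    obtain ⟨e₀, Φ₀, j₀, -, -, -, hΦ₀t⟩ := exists_aCharacter_ne_one_of_fixes_edges P₀ t ht1 i₀ hfix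
    apply hΦ₀t
    have h1 : Φ₀ t ^ orderOf t = 1 := by rw [← map_pow, pow_orderOf_eq_one, map_one]
    have h2 : Φ₀ t ^ p ^ e₀ = 1 := by
      have hcard : Nat.card (Multiplicative (ZMod (p ^ e₀))) = p ^ e₀ := by simp
      have h : Φ₀ t ^ Nat.card (Multiplicative (ZMod (p ^ e₀))) = 1 := pow_card_eq_one'
      rwa [hcard] at h
    have hcop : Nat.Coprime (orderOf t) (p ^ e₀) :=
      (Nat.Coprime.pow_right e₀ ((Nat.Prime.coprime_iff_not_dvd hp.out).mpr hdvd).symm)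
    have h3 : Φ₀ t ^ Nat.gcd (orderOf t) (p ^ e₀) = 1 := pow_gcd_eq_one.mpr ⟨h1, h2⟩
    rwa [Nat.Coprime.gcd_eq_one hcop, pow_one] at h3

/-! ### ★ Exotic compact subgroups are torsion-free -/

variable (p)

/-- ★ **Every compact subgroup of `π₁^temp(𝒢⋆(p))` lying in no verticial subgroup is TORSION-FREE** (canonical
chart; in particular every exotic maximal compact subgroup): such a subgroup fixes an edge of every level tree
(`exists_forall_mem_fixed_edge_of_forall_not_le`), so its elements of finite order are trivial.
[cite: MochizukiSemiAnbd2006, Thm 3.7(iv) p.41] -/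
theorem metabelianLeafStar_eq_one_of_isOfFinOrder_of_forall_not_le (h36 : (metabelianLeafStar p).Prop36Hypotheses)
    (K : Subgroup ((metabelianLeafStar p).temperedPiChart h36).G)
    (hKc : IsCompact (K : Set ((metabelianLeafStar p).temperedPiChart h36).G))
    (hKno : ∀ (v : (metabelianLeafStar p).graph.Vertex) (H : Subgroup ((metabelianLeafStar p).temperedPiChart h36).G),
      H ∈ verticialSubgroups ((metabelianLeafStar p).temperedPiChart h36) v → ¬ K ≤ H)
    (t : ((metabelianLeafStar p).temperedPiChart h36).G) (htK : t ∈ K) (ht : IsOfFinOrder t) : t = 1 := by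
  have hfix := exists_forall_mem_fixed_edge_of_forall_not_le (h36 := h36) K hKc hKno
  obtain ⟨t₁, rfl⟩ : ∃ t₁ : ((metabelianLeafStar p).galoisLevelData h36).temperedPi h36.isCountable, t₁ = t := ⟨t, rfl⟩
  exact eq_one_of_isOfFinOrder_of_fixes_edges t₁ ht 0 fun M _ => by
    obtain ⟨ε, hε⟩ := hfix M
    exact ⟨ε, hε t₁ htK⟩

/-- **Exotic maximal compact subgroups of `π₁^temp(𝒢⋆(p))` are torsion-free** (canonical chart).
[cite: MochizukiSemiAnbd2006, Thm 3.7(iv) p.41] -/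
theorem metabelianLeafStar_eq_one_of_isOfFinOrder_of_isMaximalCompactSubgroup
    (h36 : (metabelianLeafStar p).Prop36Hypotheses) (K₀ : Subgroup ((metabelianLeafStar p).temperedPiChart h36).G)
    (hK₀ : IsMaximalCompactSubgroup K₀)
    (hK₀no : ∀ (v : (metabelianLeafStar p).graph.Vertex) (H : Subgroup ((metabelianLeafStar p).temperedPiChart h36).G),
      H ∈ verticialSubgroups ((metabelianLeafStar p).temperedPiChart h36) v → ¬ K₀ ≤ H)
    (t : ((metabelianLeafStar p).temperedPiChart h36).G) (htK : t ∈ K₀) (ht : IsOfFinOrder t) : t = 1 :=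
  metabelianLeafStar_eq_one_of_isOfFinOrder_of_forall_not_le p h36 K₀ hK₀.1 hK₀no t htK ht

/-! ### ★ Unique `p`-th roots among exotic compact elements -/

/-- ★ **UNIQUE `p`-th ROOTS among the exotic compact elements of `π₁^temp(𝒢⋆(p))`** (canonical chart): if `a ≠ 1`
generates a compact procyclic subgroup lying in no verticial subgroup, `b` generates a compact procyclic subgroup,
and `a^p = b^p`, then `a = b`.  A maximal compact `K₀ ⊇ ⟨a⟩‾` (Zorn) lies in no verticial subgroup; `a^p ≠ 1`
(torsion-freeness) lies in `⟨b⟩‾ ⊓ K₀`, so ISOLATION gives `b ∈ K₀`; `K₀` is commutative (abc-iut-w6-d064), hence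
`(a b⁻¹)^p = a^p (b^p)⁻¹ = 1`, and `K₀` is torsion-free. [cite: MochizukiSemiAnbd2006, Thm 3.7(iv) p.41] -/
theorem metabelianLeafStar_eq_of_pow_prime_eq (h36 : (metabelianLeafStar p).Prop36Hypotheses)
    (a b : ((metabelianLeafStar p).temperedPiChart h36).G)
    (ha : IsCompact (((Subgroup.zpowers a).topologicalClosure : Subgroup ((metabelianLeafStar p).temperedPiChart h36).G) :
      Set ((metabelianLeafStar p).temperedPiChart h36).G))
    (hano : ∀ (v : (metabelianLeafStar p).graph.Vertex) (H : Subgroup ((metabelianLeafStar p).temperedPiChart h36).G),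
      H ∈ verticialSubgroups ((metabelianLeafStar p).temperedPiChart h36) v →
        ¬ ((Subgroup.zpowers a).topologicalClosure : Subgroup ((metabelianLeafStar p).temperedPiChart h36).G) ≤ H)
    (ha1 : a ≠ 1)
    (hb : IsCompact (((Subgroup.zpowers b).topologicalClosure : Subgroup ((metabelianLeafStar p).temperedPiChart h36).G) :
      Set ((metabelianLeafStar p).temperedPiChart h36).G))
    (hab : a ^ p = b ^ p) : a = b := by
  haveI : NeZero p := ⟨hp.out.ne_zero⟩
  haveI : T2Space ((metabelianLeafStar p).temperedPiChart h36).G :=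
    ((metabelianLeafStar p).galoisLevelData h36).t2Space_temperedPi h36.isCountable
  let c := (metabelianLeafStar p).temperedPiChart h36
  -- a maximal compact `K₀ ⊇ ⟨a⟩‾`, lying in no verticial subgroup
  obtain ⟨K₀, hK₀, haK₀⟩ := (metabelianLeafStar p).exists_isMaximalCompactSubgroup_ge_temperedPiChart h36 _ ha
  have hK₀no : ∀ (v : (metabelianLeafStar p).graph.Vertex) (H : Subgroup c.G), H ∈ verticialSubgroups c v →
      ¬ K₀ ≤ H := fun v H hH hle => hano v H hH (haK₀.trans hle)
  have haK : a ∈ K₀ := haK₀ (Subgroup.le_topologicalClosure _ (Subgroup.mem_zpowers a))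
  -- `a^p ≠ 1` (torsion-freeness of `K₀`)
  have hap : a ^ p ≠ 1 := by
    intro h1
    exact ha1 (metabelianLeafStar_eq_one_of_isOfFinOrder_of_isMaximalCompactSubgroup p h36 K₀ hK₀ hK₀no a haK
      (isOfFinOrder_iff_pow_eq_one.mpr ⟨p, hp.out.pos, h1⟩))
  -- `⟨b⟩‾` meets `K₀` in `b^p = a^p ≠ 1`: isolation gives `b ∈ K₀`
  have hbK : b ∈ K₀ := by
    have hle := le_of_isMaximalCompactSubgroup_of_inf_ne_bot_of_forall_not_le (h36 := h36) K₀ _ hK₀ hK₀no hb (by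
      intro hbot
      have hmem : b ^ p ∈ (Subgroup.zpowers b).topologicalClosure ⊓ K₀ :=
        ⟨Subgroup.le_topologicalClosure _ (Subgroup.pow_mem _ (Subgroup.mem_zpowers b) p),
          hab ▸ Subgroup.pow_mem _ haK p⟩
      rw [hbot, Subgroup.mem_bot] at hmem
      exact hap (hab.trans hmem))
    exact hle (Subgroup.le_topologicalClosure _ (Subgroup.mem_zpowers b))
  -- `K₀` is commutative, so `(a b⁻¹)^p = 1`, and `K₀` is torsion-free
  have hcomm : a * b = b * a := by
    rcases metabelianLeafStar_mem_verticialSubgroups_or_commutative_of_isMaximalCompactSubgroup p c K₀ hK₀ with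
      ⟨v, hK₀v⟩ | hcomm
    · exact absurd le_rfl (hK₀no v K₀ hK₀v)
    · exact hcomm a haK b hbK
  have hpow : (a * b⁻¹) ^ p = 1 := by
    rw [(Commute.inv_right hcomm).mul_pow, inv_pow, hab, mul_inv_cancel]
  have h1 := metabelianLeafStar_eq_one_of_isOfFinOrder_of_isMaximalCompactSubgroup p h36 K₀ hK₀ hK₀no (a * b⁻¹)
    (K₀.mul_mem haK (K₀.inv_mem hbK)) (isOfFinOrder_iff_pow_eq_one.mpr ⟨p, hp.out.pos, hpow⟩)
  exact mul_inv_eq_one.mp h1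

end ProfiniteSemiGraph

end Literature.AnabelianGeometry.SemiGraphs

end
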